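import Mathlib
import Summits.ResolutionOfSingularities.ResolutionOfSingularities.Theorems.SyzygyFlatteningDefs
import Summits.ResolutionOfSingularities.ResolutionOfSingularities.Theorems.SyzygyFlatteningHigherRankTerminationNrmBaseChange
import HarnessLib

/-!
# The base change `B ↦ k(X)·B ⊆ K(X)` preserves the model hypotheses (`stub_baseChange_model`)

Crux `HigherRankTermination` (stmt-ResolutionOfSingularities-17045), line `birth`, base-change line
`(k, K) ↦ (k(X), K(X))` (wave 2), registered stub `stub_baseChange_model`.

Setting. `k ⊆ K` are fields, `K(X) = RatFunc K`; `k'` is an abstract field mapped isomorphically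
onto `k(X) = IntermediateField.adjoin k {X} ⊆ K(X)` (the range hypothesis); `B : Subalgebra k K` is a
model and `E = Algebra.adjoin k' B ⊆ K(X)` (the `k'`-subalgebra generated by the image of `B`) is its
base change `k(X)·B`. The three hypotheses on models that the tower of the route needs survive:

* `B.FG → E.FG`: if `B = k[s]` for a finite `s ⊆ K` then `E = k'[s]`, because the image of
  `k[s]` lies in `k'[s]` (induction on `Algebra.adjoin`, the scalars of `k` being scalars of `k'`);
* `Frac B = K → Frac E = K(X)`: every `z ∈ K(X)` is `p / q` with `p, q ∈ K[X]`; clearing the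
  denominators of the coefficients (`IsLocalization.integerNormalization`, `K = Frac B`) writes
  `β p` and `γ q` (`β, γ ∈ B \ {0}`) as polynomials with coefficients in `B`, which lie in `E ∋ X`;
  so `z = (β p · γ) / (γ q · β)` is a quotient of elements of `E` (`IsFractionRing.of_field`);
* `B` essentially of finite type over `k` → `E` essentially of finite type over `k'`: if `B` is the
  localisation of `k[σ]` at units of `B` (`Algebra.essFiniteType_iff`), then every element `x` of
  `E = k'[B]` satisfies `x · t ∈ k'[σ]` for some `t ∈ k'[σ]` that is a unit of `E` (induction on
  `Algebra.adjoin`: a generator `b` has `b · t ∈ k[σ]` with `t` a unit of `B`, and such fractions are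
  closed under sums and products), i.e. `E` is the localisation of `k'[σ]` at units of `E`.

The three facts are proved for an arbitrary field `L ⊇ K` with compatible `k'`-structure in place of
`K(X)` where possible (only the second uses the polynomial structure of `K(X)`), and the registered
statement is a thin wrapper. Sources: folklore (base change and localisation of finitely generated
algebras, e.g. Matsumura 1987, §4; Atiyah–Macdonald ch. 3).
-/

noncomputable section

-- single-problem summit: the doubled namespace component is forced
set_option linter.dupNamespace false

namespace Summit.ResolutionOfSingularities.ResolutionOfSingularities.Theorems.SyzygyFlattening

/-! ## Images of generated subalgebras under a change of scalars -/

section general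

variable {R A R' A' : Type*} [CommSemiring R] [Semiring A] [Algebra R A]
  [CommSemiring R'] [Semiring A'] [Algebra R' A']

/-- If a ring map `φ : A → A'` sends the scalars of `R` to scalars of `R'`, then it sends the
`R`-subalgebra generated by `s` into the `R'`-subalgebra generated by `φ '' s`. [folklore] -/
theorem baseChangeModel_image_adjoin_subset (φ : A →+* A') (g : R → R')
    (hφ : ∀ c : R, φ (algebraMap R A c) = algebraMap R' A' (g c)) (s : Set A) :
    φ '' (Algebra.adjoin R s : Set A) ⊆ (Algebra.adjoin R' (φ '' s) : Set A') := by
  rintro _ ⟨x, hx, rfl⟩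
  have hx' : x ∈ Algebra.adjoin R s := hx
  clear hx
  show φ x ∈ Algebra.adjoin R' (φ '' s)
  induction hx' using Algebra.adjoin_induction with
  | mem x hx => exact Algebra.subset_adjoin ⟨x, hx, rfl⟩
  | algebraMap c =>
    rw [hφ]
    exact Subalgebra.algebraMap_mem _ _
  | add x y _ _ hx hy =>
    rw [map_add]
    exact add_mem hx hy
  | mul x y _ _ hx hy =>
    rw [map_mul]
    exact mul_mem hx hy

end general

/-! ## Finite generation and essential finiteness along `B ↦ k'[B]` -/

section fields

variable {k K k' L : Type*} [Field k] [Field K] [Algebra k K] [Field k'] [Field L]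
  [Algebra k k'] [Algebra k' L] (φ : K →+* L)
  (hφ : ∀ c : k, φ (algebraMap k K c) = algebraMap k' L (algebraMap k k' c))

include hφ in
/-- If `B = k[s]` is a finitely generated `k`-subalgebra of `K` and `φ : K → L` sends `k` into `k'`,
then `k'[φ B] = k'[φ s]` is a finitely generated `k'`-subalgebra of `L`. [folklore] -/
theorem baseChangeModel_fg (B : Subalgebra k K) (E : Subalgebra k' L)
    (hE : E = Algebra.adjoin k' (φ '' (B : Set K))) (hB : B.FG) : E.FG := by
  classical
  obtain ⟨s, hs⟩ := hB
  refine ⟨s.image φ, ?_⟩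
  rw [Finset.coe_image, hE]
  have hsB : (s : Set K) ⊆ (B : Set K) := by
    rw [← hs]
    exact Algebra.subset_adjoin
  apply le_antisymm
  · exact Algebra.adjoin_mono (Set.image_mono hsB)
  · refine Algebra.adjoin_le ?_
    rw [← hs]
    exact baseChangeModel_image_adjoin_subset φ (algebraMap k k') hφ (s : Set K)

include hφ in
/-- If `B ⊆ K` is essentially of finite type over `k` (a localisation of some `k[σ]`, `σ` finite, at
units of `B`) and `φ : K → L` sends `k` into `k'`, then `E = k'[φ B] ⊆ L` is essentially of finite
type over `k'`: every `x ∈ E` has `x · t ∈ k'[φ σ]` for some `t ∈ k'[φ σ]` that is a unit of `E`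
(induction on `Algebra.adjoin`). [folklore] -/
theorem baseChangeModel_essFiniteType (B : Subalgebra k K) (E : Subalgebra k' L)
    (hE : E = Algebra.adjoin k' (φ '' (B : Set K))) (hB : Algebra.EssFiniteType k ↥B) :
    Algebra.EssFiniteType k' ↥E := by
  classical
  -- the inclusion `ψ : B → E`
  have hmem : ∀ b : ↥B, φ b ∈ E := fun b => by
    rw [hE]
    exact Algebra.subset_adjoin ⟨b, b.2, rfl⟩
  let ψ : ↥B →+* ↥E := (φ.comp (algebraMap ↥B K)).codRestrict E hmem
  have hψ : ∀ c : k, ψ (algebraMap k ↥B c) = algebraMap k' ↥E (algebraMap k k' c) := fun c =>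
    Subtype.ext (hφ c)
  rw [Algebra.essFiniteType_iff] at hB ⊢
  obtain ⟨σ, hσ⟩ := hB
  refine ⟨σ.image ψ, ?_⟩
  have hψS : ∀ t ∈ Algebra.adjoin k (σ : Set ↥B),
      ψ t ∈ Algebra.adjoin k' ((σ.image ψ : Finset ↥E) : Set ↥E) := fun t ht => by
    have h := baseChangeModel_image_adjoin_subset ψ (algebraMap k k') hψ (σ : Set ↥B) ⟨t, ht, rfl⟩
    rwa [← Finset.coe_image] at h
  -- the claim, for all elements of `E = k'[φ B]`, by induction on `Algebra.adjoin`
  suffices h : ∀ x ∈ Algebra.adjoin k' (φ '' (B : Set K)),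
      ∃ t ∈ Algebra.adjoin k' ((σ.image ψ : Finset ↥E) : Set ↥E),
        ∃ u ∈ Algebra.adjoin k' ((σ.image ψ : Finset ↥E) : Set ↥E),
          IsUnit t ∧ x * (t : L) = (u : L) by
    intro e
    obtain ⟨t, ht, u, hu, htu, he⟩ := h e (by rw [← hE]; exact e.2)
    refine ⟨t, ht, htu, ?_⟩
    rwa [show e * t = u from Subtype.ext he]
  intro x hx
  induction hx using Algebra.adjoin_induction with
  | mem x hx =>
    obtain ⟨b, hb, rfl⟩ := hx
    obtain ⟨t, ht, htu, hbt⟩ := hσ ⟨b, hb⟩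
    refine ⟨ψ t, hψS t ht, ψ (⟨b, hb⟩ * t), hψS _ hbt, htu.map ψ, ?_⟩
    change φ b * φ (t : K) = φ ((b : K) * (t : K))
    rw [map_mul]
  | algebraMap r =>
    refine ⟨1, one_mem _, algebraMap k' ↥E r, Subalgebra.algebraMap_mem _ r, isUnit_one, ?_⟩
    rw [OneMemClass.coe_one, mul_one, Subalgebra.coe_algebraMap]
  | add x y _ _ hx hy =>
    obtain ⟨tx, htx, ux, hux, hxu, hx⟩ := hx
    obtain ⟨ty, hty, uy, huy, hyu, hy⟩ := hy
    refine ⟨tx * ty, mul_mem htx hty, ux * ty + uy * tx,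
      add_mem (mul_mem hux hty) (mul_mem huy htx), hxu.mul hyu, ?_⟩
    simp only [Subalgebra.coe_mul, Subalgebra.coe_add]
    linear_combination (ty : L) * hx + (tx : L) * hy
  | mul x y _ _ hx hy =>
    obtain ⟨tx, htx, ux, hux, hxu, hx⟩ := hx
    obtain ⟨ty, hty, uy, huy, hyu, hy⟩ := hy
    refine ⟨tx * ty, mul_mem htx hty, ux * uy, mul_mem hux huy, hxu.mul hyu, ?_⟩
    simp only [Subalgebra.coe_mul]
    linear_combination (y * ty : L) * hx + (ux : L) * hy

/-- A subalgebra `E` of a field `L` such that every element of `L` is a quotient of two elements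
of `E` has fraction field `L`. [folklore] -/
theorem baseChangeModel_isFractionRing_of_exists_div (E : Subalgebra k' L)
    (h : ∀ z : L, ∃ x ∈ E, ∃ y ∈ E, z = x / y) : IsFractionRing ↥E L :=
  IsFractionRing.of_field ↥E L fun z => by
    obtain ⟨x, hx, y, hy, rfl⟩ := h z
    exact ⟨⟨x, hx⟩, ⟨y, hy⟩, rfl⟩

end fields

/-! ## Every rational function is a quotient of elements of `E ⊇ B ∪ {X}` when `Frac B = K` -/

section ratfunc

variable {k K k' : Type*} [Field k] [Field K] [Algebra k K] [Field k'] [Algebra k' (RatFunc K)]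

/-- If `Frac B = K` and a `k'`-subalgebra `E ⊆ K(X)` contains (the image of) `B` and `X`, then
every `z ∈ K(X)` is a quotient of two elements of `E`: write `z = p / q` with `p, q ∈ K[X]` and
clear the denominators of the coefficients of `p` and `q` by non-zero elements of `B`
(`IsLocalization.integerNormalization`). [folklore] -/
theorem baseChangeModel_exists_div (B : Subalgebra k K) (hB : IsFractionRing ↥B K)
    (E : Subalgebra k' (RatFunc K)) (hBE : ∀ b ∈ B, algebraMap K (RatFunc K) b ∈ E)
    (hX : (RatFunc.X : RatFunc K) ∈ E) (z : RatFunc K) :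
    ∃ x ∈ E, ∃ y ∈ E, z = x / y := by
  haveI := hB
  -- clearing the denominators of the coefficients of a polynomial over `K = Frac B`
  have key : ∀ p : Polynomial K, ∃ b : ↥B, algebraMap K (RatFunc K) b ≠ 0 ∧
      algebraMap K (RatFunc K) b * algebraMap (Polynomial K) (RatFunc K) p ∈ E := by
    intro p
    obtain ⟨b, hb, hbp⟩ := IsLocalization.integerNormalization_spec (nonZeroDivisors ↥B) p
    refine ⟨b, ?_, ?_⟩
    · exact (map_ne_zero _).mpr fun h => nonZeroDivisors.ne_zero hb (ZeroMemClass.coe_eq_zero.mp h)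
    · have h : algebraMap (Polynomial K) (RatFunc K)
          ((IsLocalization.integerNormalization (nonZeroDivisors ↥B) p).map (algebraMap ↥B K)) =
            algebraMap K (RatFunc K) b * algebraMap (Polynomial K) (RatFunc K) p := by
        rw [hbp, algebra_compatible_smul K b p, Polynomial.smul_eq_C_mul, map_mul,
          RatFunc.algebraMap_C, ← RatFunc.algebraMap_eq_C]
        rfl
      rw [← h]
      exact algebraMap_polynomial_mem_adjoin B E hBE hX _ fun n => by
        rw [Polynomial.coeff_map]
        exact Subtype.coe_prop _
  refine RatFunc.induction_on (P := fun z => ∃ x ∈ E, ∃ y ∈ E, z = x / y) z fun p q hq => ?_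
  obtain ⟨b, hb0, hbp⟩ := key p
  obtain ⟨c, hc0, hcq⟩ := key q
  refine ⟨_, mul_mem hbp (hBE c c.2), _, mul_mem hcq (hBE b b.2), ?_⟩
  have hq' : algebraMap (Polynomial K) (RatFunc K) q ≠ 0 := RatFunc.algebraMap_ne_zero hq
  rw [div_eq_div_iff hq' (mul_ne_zero (mul_ne_zero hc0 hq') hb0)]
  ring

end ratfunc

/-! ## The registered stub -/

/-- **STUB `stub_baseChange_model`.** The base change `B ↦ E = k(X)·B ⊆ K(X)` (the `k(X)`-subalgebra
of `K(X)` generated by a `k`-subalgebra `B ⊆ K`) preserves the three model hypotheses: finite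
generation (`k[s] ↦ k(X)[s]`), being a model of the ambient field (`Frac B = K ⇒ Frac E = K(X)`:
clear denominators of the coefficients of numerator and denominator of a rational function), and
essential finiteness (`B` a localisation of `k[σ]` at units ⇒ `E` a localisation of `k(X)[σ]` at
units). [folklore] -/
theorem stub_baseChange_model : ∀ (k K : Type) [Field k] [Field K] [Algebra k K],
    ∀ (k' : Type) [Field k'] [Algebra k k'] [Algebra k' (RatFunc K)] [IsScalarTower k k' (RatFunc K)],
      Set.range (algebraMap k' (RatFunc K)) =
        ((IntermediateField.adjoin k {(RatFunc.X : RatFunc K)} : IntermediateField k (RatFunc K)) :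
          Set (RatFunc K)) →
    ∀ (B : Subalgebra k K) (E : Subalgebra k' (RatFunc K)),
      E = Algebra.adjoin k' ((algebraMap K (RatFunc K)) '' (B : Set K)) →
      (B.FG → E.FG) ∧ (IsFractionRing ↥B K → IsFractionRing ↥E (RatFunc K)) ∧
        (Algebra.EssFiniteType k ↥B → Algebra.EssFiniteType k' ↥E) := by
  intro k K _ _ _ k' _ _ _ _ hrange B E hE
  -- the scalars of `k` are scalars of `k'` inside `K(X)`
  have hφ : ∀ c : k, algebraMap K (RatFunc K) (algebraMap k K c) =
      algebraMap k' (RatFunc K) (algebraMap k k' c) := fun c => by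
    rw [← IsScalarTower.algebraMap_apply k K (RatFunc K) c,
      ← IsScalarTower.algebraMap_apply k k' (RatFunc K) c]
  -- `X ∈ k' ⊆ E` and `B ⊆ E`
  have hX : (RatFunc.X : RatFunc K) ∈ E := by
    have h : (RatFunc.X : RatFunc K) ∈ Set.range (algebraMap k' (RatFunc K)) := by
      rw [hrange]
      exact IntermediateField.mem_adjoin_simple_self k (RatFunc.X : RatFunc K)
    obtain ⟨x, hx⟩ := h
    rw [← hx]
    exact Subalgebra.algebraMap_mem E x
  have hBE : ∀ b ∈ B, algebraMap K (RatFunc K) b ∈ E := fun b hb => by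
    rw [hE]
    exact Algebra.subset_adjoin ⟨b, hb, rfl⟩
  exact ⟨baseChangeModel_fg (algebraMap K (RatFunc K)) hφ B E hE,
    fun hfr => baseChangeModel_isFractionRing_of_exists_div E
      (baseChangeModel_exists_div B hfr E hBE hX),
    baseChangeModel_essFiniteType (algebraMap K (RatFunc K)) hφ B E hE⟩

end Summit.ResolutionOfSingularities.ResolutionOfSingularities.Theorems.SyzygyFlattening

end
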